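import Mathlib
import Summits.MatrixMultiplication.MatrixMultiplication.Theorems.SnSubsetDichotomyNoThresholdSubsetTripleIncrBounded
import Summits.MatrixMultiplication.MatrixMultiplication.Theorems.SnSubsetDichotomyNoThresholdSubsetTripleTransProbSum
import Summits.MatrixMultiplication.MatrixMultiplication.Theorems.SnSubsetDichotomyNoThresholdSubsetTriplePlancherelStepDefs

/-!
# One Plancherel step inside the `3√n`-box: bounded increment and bounded drift
# (route `SnSubsetDichotomy`, crux `NoThresholdSubsetTriple`)

Stub `oneStep_box_bounds` of line `klr-graded-polynomial-method` (stmt-MatrixMultiplication-8302), the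
deterministic bounded-increment hypothesis of Freedman's inequality in the lead-c8 Freedman split.

For `n ≥ 1` and a Young diagram `Y` (a finite lower set of cells) all of whose cells `(i, j)` satisfy
`i, j < 3√n`:

* `|x_z| ≤ 8√n` for every node `z`, where `x_z = incr Y z = R(row z) − C(col z)` is the J-increment;
* `|m(Y)| ≤ 8√n` for the conditional drift `m(Y) = Σ_{z addable} p_z · (−1)^{row z + col z} · x_z`
  (`p_z = transProb Y z`).

Proof.  (a) With `R = K = ⌈3√n⌉₊` every cell has row `< R` and column `< K` (`Nat.lt_ceil`), so the tree
bound `abs_incr_le_of_bounded` gives `|x_z| ≤ R + K = 2⌈3√n⌉₊ < 2(3√n + 1) ≤ 8√n`, using `1 ≤ √n`.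
(b) `|Σ p_z π_z x_z| ≤ Σ p_z |x_z| ≤ 8√n Σ p_z = 8√n` by `p_z ≥ 0` (`transProb_nonneg`) and
`Σ_{z addable} p_z = 1` (`transProb_sum_eq_one`, Greene–Nijenhuis–Wilf).
-/

open scoped BigOperators
open Literature.RepresentationTheory.FiniteGroups (addableNodes)

namespace Summit.MatrixMultiplication.MatrixMultiplication.Theorems

open PlancherelStep

set_option linter.dupNamespace false in -- deliberate Summit.<S>.<P> duplicate
/-- **One step inside the box.** For `n ≥ 1` and a Young diagram `Y` (finite lower set) whose cells
have row and column index `< 3√n`: every J-increment satisfies `|x_z| ≤ 8√n`, and the conditional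
drift `m(Y) = Σ_{z addable} p_z (−1)^{row z + col z} x_z` satisfies `|m(Y)| ≤ 8√n` (the `p_z ≥ 0` sum
to one).  Bookkeeping from `abs_incr_le_of_bounded` with `R = K = ⌈3√n⌉₊` and
`transProb_sum_eq_one`. [folklore] -/
theorem oneStep_box_bounds : ∀ (n : ℕ), 1 ≤ n → ∀ (Y : Finset (ℕ × ℕ)), IsLowerSet (Y : Set (ℕ × ℕ)) →
    (∀ x ∈ Y, (x.1 : ℝ) < 3 * Real.sqrt n ∧ (x.2 : ℝ) < 3 * Real.sqrt n) →
    (∀ z : ℕ × ℕ, |((PlancherelStep.incr Y z : ℤ) : ℝ)| ≤ 8 * Real.sqrt n) ∧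
    |∑ z ∈ Literature.RepresentationTheory.FiniteGroups.addableNodes Y,
      PlancherelStep.transProb Y z * ((-1 : ℝ) ^ (z.1 + z.2) * (PlancherelStep.incr Y z : ℝ))| ≤
      8 * Real.sqrt n := by
  intro n hn Y hY hbox
  have hsqrt : 1 ≤ Real.sqrt n := Real.one_le_sqrt.2 (by exact_mod_cast hn)
  have hceil : (⌈3 * Real.sqrt n⌉₊ : ℝ) < 3 * Real.sqrt n + 1 := Nat.ceil_lt_add_one (by positivity)
  have hboxN : ∀ x ∈ Y, x.1 < ⌈3 * Real.sqrt n⌉₊ ∧ x.2 < ⌈3 * Real.sqrt n⌉₊ := fun x hx =>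
    ⟨Nat.lt_ceil.2 (hbox x hx).1, Nat.lt_ceil.2 (hbox x hx).2⟩
  have hincr : ∀ z : ℕ × ℕ, |((incr Y z : ℤ) : ℝ)| ≤ 8 * Real.sqrt n := by
    intro z
    have h1 : |((incr Y z : ℤ) : ℝ)| ≤ ((⌈3 * Real.sqrt n⌉₊ + ⌈3 * Real.sqrt n⌉₊ : ℕ) : ℝ) := by
      rw [← Int.cast_abs]
      exact_mod_cast abs_incr_le_of_bounded Y _ _ hboxN z
    refine h1.trans ?_
    push_cast
    linarith
  refine ⟨hincr, ?_⟩
  calc |∑ z ∈ addableNodes Y, transProb Y z * ((-1 : ℝ) ^ (z.1 + z.2) * (incr Y z : ℝ))|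
      ≤ ∑ z ∈ addableNodes Y, |transProb Y z * ((-1 : ℝ) ^ (z.1 + z.2) * (incr Y z : ℝ))| :=
        Finset.abs_sum_le_sum_abs _ _
    _ ≤ ∑ z ∈ addableNodes Y, transProb Y z * (8 * Real.sqrt n) := by
        refine Finset.sum_le_sum fun z _ => ?_
        rw [abs_mul, abs_of_nonneg (transProb_nonneg Y z), abs_mul, abs_pow, abs_neg, abs_one,
          one_pow, one_mul]
        exact mul_le_mul_of_nonneg_left (hincr z) (transProb_nonneg Y z)
    _ = 8 * Real.sqrt n := by
        rw [← Finset.sum_mul, transProb_sum_eq_one Y hY, one_mul]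

end Summit.MatrixMultiplication.MatrixMultiplication.Theorems
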